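import Summits.BirchSwinnertonDyer.BirchSwinnertonDyer.Theorems.ByReductionTypeAtTwoOrdKatoHalfAtTwoIsoSelmerDualAllPrimeLocal
import Summits.BirchSwinnertonDyer.BirchSwinnertonDyer.Theorems.ByReductionTypeAtTwoOrdKatoHalfAtTwoIsoSelmerDualAllPrimePlaces
import Summits.BirchSwinnertonDyer.BirchSwinnertonDyer.Theorems.SmallImageMuTransferMuTransferX9SelmerDualStub
import HarnessLib

/-!
# Route ByReductionTypeAtTwo, crux `OrdKatoHalfAtTwoIso` (stmt-BirchSwinnertonDyer-19573), line
# `steinberg-fibre-at-two`: the Selmer-side stub `hG1` of the odd core WITHOUT `p ≠ 2`, part 3 (assembly)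

Seat `cruxlead-stmt-BirchSwinnertonDyer-19573-g0` (LEAD PROVER, MODE LINE), helper W2c (PLAN C).
HONEST FRAMING (cell bsd-2adic): BSD is not proved; the crux `OrdKatoHalfAtTwoIso` is not proved; `stub_port`
is not proved here. Theorems only (no definition, no named fact, no `sorry`); nothing is asserted about any
curve and nothing is booked (`--supports stmt-BirchSwinnertonDyer-19573 --as helper`).

WHAT. The ALL-PRIME (in particular `p = 2`) twin of `hG1 = SelmerDual.stub_selmerDualOdd_holds`
(`…X9SelmerDualStub`, k6-c2 p465845; MU-TRANSFER-PROOF §5 STEP 1, Selmer side): for `y ∈ H¹(ℚ_∞, E[p])` fine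
with `(conj_γ − 1)^J y ≠ 0` there is `Ψ ∈ H¹(ℚ, 𝒯_{J+1}(E, κ⁻¹))` of exact `T`-order `> J`, unramified off a
finite `S ⊇ S₀`, killed by `T^ε` on `S`, with `ε` uniform.  The odd proof's `p ≠ 2` entered at ONE place
(unipotent ⟹ nilpotent, part 1 `…SelmerDualAllPrimeLocal`); its `¬ W.HasSurjectiveModNGaloisRep p`, (EP) and
(PT) binders were never consumed (pass-through in `localBad` / `localP` / `localUnramified` / the assembly);
its `W.HasIrreducibleModPGaloisRep p` IS consumed, once: `E[p]^{Γ_ℚ} = 0`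
(`LevelE.torsionGaloisModule_fixed_eq_zero_of_irr`) for the avatar `Ψ` of exact level
(`ZpExtension.exists_level_class_of_shiftH1_iterate_ne_zero`).  Hence:

* `localP'` — twin of `SelmerDual.localP` (hypothesis (L-p) at the place over `p`), binders `κ.IsCyclotomic`,
  `κ.IsTopGenerator γ` only; proof = the odd one over part 1's `localP_of'`.
* `stub_selmerDual_holds_allPrime` — the statement of `stub_selmerDualOdd_holds` with the prefix
  `p ≠ 2 → Irr → ¬Surj → cyc → topgen → (EP) → (PT) →` replaced by EXACTLY the consumed binders
  `W.HasIrreducibleModPGaloisRep p → κ.IsCyclotomic → κ.IsTopGenerator γ →`; proof = lur-a's assembly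
  `stub_selmerDualOdd_of_localP` re-run over `localBad'`, `localP'`, `localUnramified'`. Every prime `p`.
* `stub_selmerDual_holds'` — the same in the odd stub's VERBATIM binder shape minus `p ≠ 2 →` and minus
  `¬ W.HasSurjectiveModNGaloisRep p →` (keeps the inert (EP), (PT) binders of `CoreAssembly`'s `hG1` slot).
* `stub_selmerDualTwo_holds` — the instance `p = 2` in the spelling of `SteinbergFibreAtTwo.CoreTheoremATwoResidue`
  (`ZpExtension ℚ 2`, `E[2] = geomTorsion W (2 : ℤ)`): binders `W.HasIrreducibleModPGaloisRep 2` (on the DD12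
  residue `ρ̄₂` is onto `GL₂(𝔽₂)`, so `E[2]` is irreducible), `κ.IsCyclotomic`, `κ.IsTopGenerator γ`.

Credit: sidea-stub_port-1 STUB-IDEAS-1 @82c64e14eec0e2be Plan C («near-verbatim»); seats bsd-smallim-k6-c2 /
k6-lur-a / k6-g4 (odd originals p465845, p462896, p456573).

References: HOME/koly/MU-TRANSFER-PROOF.md §5 STEP 1; R. Greenberg, LNM 1716 (1999) §3 [GreenbergLNM1716];
B. Mazur, K. Rubin, Mem. AMS 799 (2004) §5.3 [MazurRubin2004]; J. S. Milne, *ADT* I 4.10 [MilneADT2006].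
-/

set_option linter.dupNamespace false
set_option autoImplicit false

noncomputable section

open scoped Classical NumberField
open Field IsDedekindDomain Function
open WeierstrassCurve (geomTorsion geomPrimaryTorsion)
open Literature.NumberTheory.GaloisRepresentations
open Literature.NumberTheory.GaloisCohomology
open Literature.NumberTheory.EllipticCurves
open Literature.NumberTheory.EllipticCurves.GreenbergSelmer

namespace Summit.BirchSwinnertonDyer.BirchSwinnertonDyer.Rank1Residual.SelmerDual

/-! ## (L-p) over `ℚ`, every prime -/

-- adapted from `SelmerDual.localP` (…X9SelmerDualStub, k6-c2 p465845): `hp2` and the dead prefix binders struck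
/-- **(L-p), every prime `p`** — the uniform local exponent at the place above `p` for the Selmer-side classes
`Ψ` built from FINE classes `y` (binders: `κ` cyclotomic, `γ` a topological generator): part 1's `localP_of'`
(Shapiro + one-double-coset Mackey + the all-prime uniform local exponent of a fine class at the totally
ramified `p`) fed with lur-b's total ramification `exists_mem_decomp_inv_mul_mem_kerSubgroup` and local embed
kernel `localization_shiftH1_iterate_eq_zero_of_localization_map_shiftEmbed_eq_zero` at a depth element of
`κ⁻¹` over `p`. [cite: GreenbergLNM1716, §3] [cite: MazurRubin2004, §5.3] -/
theorem localP' :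
    ∀ (W : WeierstrassCurve ℚ) [W.IsElliptic] [W.IsGloballyMinimal] (p : ℕ) [Fact p.Prime]
      (κ : ZpExtension ℚ p) (γ : absoluteGaloisGroup ℚ),
      κ.IsCyclotomic → κ.IsTopGenerator γ →
      ∃ εp : ℕ, ∀ (v : HeightOneSpectrum (𝓞 ℚ)), ((p : ℕ) : 𝓞 ℚ) ∈ v.asIdeal →
        ∀ (J n : ℕ) (hJn : J + 1 ≤ p ^ n)
          (y : Literature.NumberTheory.EllipticCurves.subgroupH1 κ.kerSubgroup
            (WeierstrassCurve.geomTorsion W (p : ℤ))),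
          W.torsionToPrimaryH1Sub p κ.kerSubgroup y ∈ W.fineSelmerInfty κ →
          ∀ (yn : Literature.NumberTheory.EllipticCurves.subgroupH1 (κ.invTwist.layerSubgroup n)
              (WeierstrassCurve.geomTorsion W (p : ℤ)))
            (Y : galoisCohomology (W.modPTwist p κ.invTwist (p ^ n)) 1)
            (Ψ : galoisCohomology (W.modPTwist p κ.invTwist (J + 1)) 1) (k : ℕ),
            Literature.NumberTheory.EllipticCurves.resOfLe (WeierstrassCurve.geomTorsion W (p : ℤ))
                (κ.invTwist.kerSubgroup_le_layerSubgroup n) yn =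
              Literature.NumberTheory.EllipticCurves.resOfLe (WeierstrassCurve.geomTorsion W (p : ℤ))
                (κ.kerSubgroup_unitTwist (-1)).le y →
            κ.invTwist.twistModPH1Equiv (W.torsionGaloisModule (p : ℤ))
              (fun P : WeierstrassCurve.geomTorsion W (p : ℤ) => AddSubgroup.torsionBy.nsmul P) n Y = yn →
            galoisCohomology.map (κ.invTwist.twistModPShiftEmbed (W.torsionGaloisModule (p : ℤ))
              (fun P : WeierstrassCurve.geomTorsion W (p : ℤ) => AddSubgroup.torsionBy.nsmul P) (p ^ n) hJn)
                1 Ψ =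
              (κ.invTwist.shiftH1 (W.torsionGaloisModule (p : ℤ))
                (fun P : WeierstrassCurve.geomTorsion W (p : ℤ) => AddSubgroup.torsionBy.nsmul P)
                (p ^ n))^[k] Y →
            ∀ ε' : ℕ, εp ≤ ε' →
              galoisCohomology.localization (W.modPTwist p κ.invTwist (J + 1)) (Sum.inr v) 1
                ((κ.invTwist.shiftH1 (W.torsionGaloisModule (p : ℤ))
                  (fun P : WeierstrassCurve.geomTorsion W (p : ℤ) => AddSubgroup.torsionBy.nsmul P)
                  (J + 1))^[ε'] Ψ) = 0 := by
  intro W _ _ p _ κ γ hκ hγ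
  classical
  have hp : p.Prime := Fact.out
  by_cases hex : ∃ v₀ : HeightOneSpectrum (𝓞 ℚ), ((p : ℕ) : 𝓞 ℚ) ∈ v₀.asIdeal
  swap
  · exact ⟨0, fun v hv => absurd ⟨v, hv⟩ hex⟩
  obtain ⟨v₀, hv₀⟩ := hex
  -- a depth element for `κ⁻¹` over `p`, acting trivially on `E[p]` (k6-g4), from total ramification (lur-b)
  haveI : Finite (geomTorsion W (p : ℤ)) :=
    WeierstrassCurve.finite_torsionPoints_holds W (AlgebraicClosure ℚ) (Int.natCast_ne_zero.mpr hp.ne_zero)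
  obtain ⟨τ, hτ⟩ := exists_apply_absGaloisRestrict_ne_one κ hκ v₀ hv₀
  have hτ' : κ.invTwist (absGaloisRestrict ℚ (v₀.adicCompletion ℚ) τ) ≠ 1 := by
    intro h1
    apply hτ
    apply Multiplicative.toAdd.injective
    have h2 := congrArg Multiplicative.toAdd h1
    rw [ZpExtension.toAdd_invTwist_apply, toAdd_one, neg_eq_zero] at h2
    rw [h2, toAdd_one]
  obtain ⟨g, m, hg, -, hgm, hgm'⟩ := LocalSplitPrime.exists_trivial_depth_of_apply_ne_one
    (W.torsionGaloisModule (p : ℤ)) κ.invTwist v₀ τ hτ'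
  have hd : Nat.card (geomTorsion W (p : ℤ)) ≤ p ^ Nat.card (geomTorsion W (p : ℤ)) :=
    (Nat.lt_pow_self hp.one_lt).le
  have h3 : ∃ e : ℕ, ∀ {J L : ℕ} (hJL : J ≤ L) (c : galoisCohomology (W.modPTwist p κ.invTwist J) 1),
      galoisCohomology.localization (W.modPTwist p κ.invTwist L) (Sum.inr v₀) 1
          (galoisCohomology.map (κ.invTwist.twistModPShiftEmbed (W.torsionGaloisModule (p : ℤ))
            (fun P : geomTorsion W (p : ℤ) => AddSubgroup.torsionBy.nsmul P) L hJL) 1 c) = 0 →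
        galoisCohomology.localization (W.modPTwist p κ.invTwist J) (Sum.inr v₀) 1
          ((κ.invTwist.shiftH1 (W.torsionGaloisModule (p : ℤ))
            (fun P : geomTorsion W (p : ℤ) => AddSubgroup.torsionBy.nsmul P) J)^[e] c) = 0 :=
    ⟨Nat.card (geomTorsion W (p : ℤ)) * p ^ m, fun hJL c hc =>
      localization_shiftH1_iterate_eq_zero_of_localization_map_shiftEmbed_eq_zero
        (W.torsionGaloisModule (p : ℤ)) (fun P : geomTorsion W (p : ℤ) => AddSubgroup.torsionBy.nsmul P)
        κ.invTwist v₀ hg hgm hgm' hd hJL c hc⟩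
  obtain ⟨εp, hεp⟩ := localP_of' W κ v₀ hγ hv₀
    (fun g => exists_mem_decomp_inv_mul_mem_kerSubgroup κ hκ v₀ hv₀ g) h3
  refine ⟨εp, fun v hv => ?_⟩
  obtain rfl := Literature.NumberTheory.Automorphic.heightOneSpectrum_rat_eq_of_natCast_mem hp hv hv₀
  exact hεp

/-! ## The all-prime `hG1` -/

-- adapted from `SelmerDual.stub_selmerDualOdd_of_localP` (…X9SelmerDualLocalUnramified, k6-lur-a p462896)
/-- **`hG1` at EVERY prime, with exactly the consumed binders** (`E[p]` irreducible, `κ` cyclotomic, `γ` a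
topological generator): for every finite `S₀` there are a uniform `ε` and a finite `S ⊇ S₀` such that every
FINE `y ∈ H¹(ℚ_∞, E[p])` with `(conj_γ − 1)^{[J]} y ≠ 0` yields `Ψ ∈ H¹(ℚ, 𝒯_{J+1}(E, κ⁻¹))` with `T^J Ψ ≠ 0`,
`loc_v Ψ` unramified off `S`, `loc_v (T^ε Ψ) = 0` on `S`.  MU-TRANSFER-PROOF §5 STEP 1 (Selmer side).
[cite: GreenbergLNM1716, §3 Lemma 3.2] [cite: MazurRubin2004, §5.3] [cite: MilneADT2006, Ch. I, Thm. 4.10] -/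
theorem stub_selmerDual_holds_allPrime :
    ∀ (W : WeierstrassCurve ℚ) [W.IsElliptic] [W.IsGloballyMinimal] (p : ℕ) [Fact p.Prime]
      (κ : ZpExtension ℚ p) (γ : absoluteGaloisGroup ℚ),
      W.HasIrreducibleModPGaloisRep p → κ.IsCyclotomic → κ.IsTopGenerator γ →
      ∀ (S₀ : Set (HeightOneSpectrum (𝓞 ℚ))), S₀.Finite →
      ∃ (ε : ℕ) (S : Set (HeightOneSpectrum (𝓞 ℚ))), S.Finite ∧ S₀ ⊆ S ∧
        ∀ (J : ℕ) (y : Literature.NumberTheory.EllipticCurves.subgroupH1 κ.kerSubgroup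
            (WeierstrassCurve.geomTorsion W (p : ℤ))),
          W.torsionToPrimaryH1Sub p κ.kerSubgroup y ∈ W.fineSelmerInfty κ →
          (⇑(Literature.NumberTheory.EllipticCurves.conjH1 κ.kerSubgroup
              (WeierstrassCurve.geomTorsion W (p : ℤ)) γ -
            AddMonoidHom.id (Literature.NumberTheory.EllipticCurves.subgroupH1 κ.kerSubgroup
              (WeierstrassCurve.geomTorsion W (p : ℤ)))))^[J] y ≠ 0 →
          ∃ Ψ : galoisCohomology (W.modPTwist p κ.invTwist (J + 1)) 1,
            (κ.invTwist.shiftH1 (W.torsionGaloisModule (p : ℤ))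
                (fun P : WeierstrassCurve.geomTorsion W (p : ℤ) => AddSubgroup.torsionBy.nsmul P)
                (J + 1))^[J] Ψ ≠ 0 ∧
            (∀ v : HeightOneSpectrum (𝓞 ℚ), v ∉ S →
              galoisCohomology.localization (W.modPTwist p κ.invTwist (J + 1)) (Sum.inr v) 1 Ψ ∈
                DiscreteGaloisModule.unramifiedSubgroup
                  (GaloisRep.toLocal v (W.modPTwist p κ.invTwist (J + 1))) 1) ∧
            (∀ v : HeightOneSpectrum (𝓞 ℚ), v ∈ S →
              galoisCohomology.localization (W.modPTwist p κ.invTwist (J + 1)) (Sum.inr v) 1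
                ((κ.invTwist.shiftH1 (W.torsionGaloisModule (p : ℤ))
                  (fun P : WeierstrassCurve.geomTorsion W (p : ℤ) => AddSubgroup.torsionBy.nsmul P)
                  (J + 1))^[ε] Ψ) = 0) := by
  intro W _ _ p _ κ γ hirr hκ hγ S₀ hS₀
  have hp : p.Prime := Fact.out
  -- the local inputs for this `(W, p, κ, γ)` — all-prime twins
  have hbad := localBad' W p κ hκ
  obtain ⟨εp, hpl⟩ := localP' W p κ γ hκ hγ
  have hur := localUnramified' W p κ
  -- the exceptional set `S ⊇ S₀`: off `S`, `v ∤ p`, good reduction, `E[p]` unramified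
  obtain ⟨S, hS, hS₀S, hSoff⟩ :=
    TorsionUnramified.exists_finite_superset_isUnramifiedAt_torsionGaloisModule W hp.ne_zero hS₀
  -- the uniform exponent: `ε = εp + max_{v ∈ S, v ∤ p} ε_v`
  let f : HeightOneSpectrum (𝓞 ℚ) → ℕ := fun v =>
    if h : ((p : ℕ) : 𝓞 ℚ) ∉ v.asIdeal then Classical.choose (hbad v h) else 0
  have hf : ∀ (v : HeightOneSpectrum (𝓞 ℚ)) (h : ((p : ℕ) : 𝓞 ℚ) ∉ v.asIdeal)
      (J : ℕ) (c : galoisCohomology (W.modPTwist p κ.invTwist J) 1),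
      galoisCohomology.localization (W.modPTwist p κ.invTwist J) (Sum.inr v) 1
        ((κ.invTwist.shiftH1 (W.torsionGaloisModule (p : ℤ))
          (fun P : WeierstrassCurve.geomTorsion W (p : ℤ) => AddSubgroup.torsionBy.nsmul P) J)^[f v] c) = 0 := by
    intro v h J c
    have hfv : f v = Classical.choose (hbad v h) := dif_pos h
    rw [hfv]
    exact Classical.choose_spec (hbad v h) J c
  set ε : ℕ := εp + hS.toFinset.sup f with hεdef
  refine ⟨ε, S, hS, hS₀S, fun J y hy hyT => ?_⟩
  -- the algebraic half: `Y = Sh⁻¹(y_n)` at a layer `n` with `J + 1 ≤ p^n`, then the avatar `Ψ`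
  obtain ⟨n₀, hn₀⟩ := exists_invTwist_class_of_iterate_ne_zero W p κ hγ J y hyT
  set n : ℕ := max n₀ (J + 1) with hndef
  have hJn : J + 1 ≤ p ^ n :=
    le_trans (le_max_right n₀ (J + 1)) (Nat.lt_pow_self hp.one_lt).le
  obtain ⟨yn, Y, hyn, hSh, hYT⟩ := hn₀ n (le_max_left n₀ (J + 1))
  -- `E[p]^{Γ_ℚ} = 0` — the ONE use of irreducibility
  have hinv := LevelE.torsionGaloisModule_fixed_eq_zero_of_irr W p hirr
  obtain ⟨k, Ψ, hΨT, hΨemb⟩ := κ.invTwist.exists_level_class_of_shiftH1_iterate_ne_zero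
    (W.torsionGaloisModule (p : ℤ)) (fun P => AddSubgroup.torsionBy.nsmul P) hinv hJn Y hYT
  refine ⟨Ψ, hΨT, fun v hv => ?_, fun v hv => ?_⟩
  · -- unramified off `S`
    obtain ⟨hvp, hgood, hvur⟩ := hSoff v hv
    exact hur v hvp hvur hgood J n hJn y hy yn Y Ψ k hyn hSh hΨemb
  · -- `T^ε`-killed on `S`
    by_cases hvp : ((p : ℕ) : 𝓞 ℚ) ∈ v.asIdeal
    · exact hpl v hvp J n hJn y hy yn Y Ψ k hyn hSh hΨemb ε (Nat.le_add_right εp _)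
    · have hfle : f v ≤ hS.toFinset.sup f := Finset.le_sup (hS.mem_toFinset.mpr hv)
      have hε : ε = f v + (ε - f v) := by omega
      rw [hε, Function.iterate_add_apply]
      exact hf v hvp (J + 1) _

/-- **`hG1` at every prime in the odd stub's verbatim binder shape** (`stub_selmerDualOdd_holds` with
`p ≠ 2 →` and `¬ W.HasSurjectiveModNGaloisRep p →` deleted; the (EP), (PT) binders are inert).
[cite: GreenbergLNM1716, §3 Lemma 3.2] [cite: MazurRubin2004, §5.3] -/
theorem stub_selmerDual_holds' :
    ∀ (W : WeierstrassCurve ℚ) [W.IsElliptic] [W.IsGloballyMinimal] (p : ℕ) [Fact p.Prime]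
      (κ : ZpExtension ℚ p) (γ : absoluteGaloisGroup ℚ),
      W.HasIrreducibleModPGaloisRep p →
      κ.IsCyclotomic → κ.IsTopGenerator γ →
      (∀ v : HeightOneSpectrum (𝓞 ℚ), localEulerPoincareCharacteristic (v.adicCompletion ℚ)) →
      poitouTate_sum_localTatePairing_eq_zero ℚ →
      ∀ (S₀ : Set (HeightOneSpectrum (𝓞 ℚ))), S₀.Finite →
      ∃ (ε : ℕ) (S : Set (HeightOneSpectrum (𝓞 ℚ))), S.Finite ∧ S₀ ⊆ S ∧
        ∀ (J : ℕ) (y : Literature.NumberTheory.EllipticCurves.subgroupH1 κ.kerSubgroup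
            (WeierstrassCurve.geomTorsion W (p : ℤ))),
          W.torsionToPrimaryH1Sub p κ.kerSubgroup y ∈ W.fineSelmerInfty κ →
          (⇑(Literature.NumberTheory.EllipticCurves.conjH1 κ.kerSubgroup
              (WeierstrassCurve.geomTorsion W (p : ℤ)) γ -
            AddMonoidHom.id (Literature.NumberTheory.EllipticCurves.subgroupH1 κ.kerSubgroup
              (WeierstrassCurve.geomTorsion W (p : ℤ)))))^[J] y ≠ 0 →
          ∃ Ψ : galoisCohomology (W.modPTwist p κ.invTwist (J + 1)) 1,
            (κ.invTwist.shiftH1 (W.torsionGaloisModule (p : ℤ))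
                (fun P : WeierstrassCurve.geomTorsion W (p : ℤ) => AddSubgroup.torsionBy.nsmul P)
                (J + 1))^[J] Ψ ≠ 0 ∧
            (∀ v : HeightOneSpectrum (𝓞 ℚ), v ∉ S →
              galoisCohomology.localization (W.modPTwist p κ.invTwist (J + 1)) (Sum.inr v) 1 Ψ ∈
                DiscreteGaloisModule.unramifiedSubgroup
                  (GaloisRep.toLocal v (W.modPTwist p κ.invTwist (J + 1))) 1) ∧
            (∀ v : HeightOneSpectrum (𝓞 ℚ), v ∈ S →
              galoisCohomology.localization (W.modPTwist p κ.invTwist (J + 1)) (Sum.inr v) 1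
                ((κ.invTwist.shiftH1 (W.torsionGaloisModule (p : ℤ))
                  (fun P : WeierstrassCurve.geomTorsion W (p : ℤ) => AddSubgroup.torsionBy.nsmul P)
                  (J + 1))^[ε] Ψ) = 0) := by
  intro W _ _ p _ κ γ hirr hκ hγ _ _
  exact stub_selmerDual_holds_allPrime W p κ γ hirr hκ hγ

/-- **`hG1` AT `p = 2`** in the spelling of `SteinbergFibreAtTwo.CoreTheoremATwoResidue` (`E[2]`,
`ZpExtension ℚ 2`): binders `W.HasIrreducibleModPGaloisRep 2`, `κ.IsCyclotomic`, `κ.IsTopGenerator γ`.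
[cite: GreenbergLNM1716, §3 Lemma 3.2] [cite: MazurRubin2004, §5.3] -/
theorem stub_selmerDualTwo_holds :
    ∀ (W : WeierstrassCurve ℚ) [W.IsElliptic] [W.IsGloballyMinimal]
      (κ : ZpExtension ℚ 2) (γ : absoluteGaloisGroup ℚ),
      W.HasIrreducibleModPGaloisRep 2 → κ.IsCyclotomic → κ.IsTopGenerator γ →
      ∀ (S₀ : Set (HeightOneSpectrum (𝓞 ℚ))), S₀.Finite →
      ∃ (ε : ℕ) (S : Set (HeightOneSpectrum (𝓞 ℚ))), S.Finite ∧ S₀ ⊆ S ∧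
        ∀ (J : ℕ) (y : Literature.NumberTheory.EllipticCurves.subgroupH1 κ.kerSubgroup
            (WeierstrassCurve.geomTorsion W (2 : ℤ))),
          W.torsionToPrimaryH1Sub 2 κ.kerSubgroup y ∈ W.fineSelmerInfty κ →
          (⇑(Literature.NumberTheory.EllipticCurves.conjH1 κ.kerSubgroup
              (WeierstrassCurve.geomTorsion W (2 : ℤ)) γ -
            AddMonoidHom.id (Literature.NumberTheory.EllipticCurves.subgroupH1 κ.kerSubgroup
              (WeierstrassCurve.geomTorsion W (2 : ℤ)))))^[J] y ≠ 0 →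
          ∃ Ψ : galoisCohomology (W.modPTwist 2 κ.invTwist (J + 1)) 1,
            (κ.invTwist.shiftH1 (W.torsionGaloisModule (2 : ℤ))
                (fun P : WeierstrassCurve.geomTorsion W (2 : ℤ) => AddSubgroup.torsionBy.nsmul P)
                (J + 1))^[J] Ψ ≠ 0 ∧
            (∀ v : HeightOneSpectrum (𝓞 ℚ), v ∉ S →
              galoisCohomology.localization (W.modPTwist 2 κ.invTwist (J + 1)) (Sum.inr v) 1 Ψ ∈
                DiscreteGaloisModule.unramifiedSubgroup
                  (GaloisRep.toLocal v (W.modPTwist 2 κ.invTwist (J + 1))) 1) ∧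
            (∀ v : HeightOneSpectrum (𝓞 ℚ), v ∈ S →
              galoisCohomology.localization (W.modPTwist 2 κ.invTwist (J + 1)) (Sum.inr v) 1
                ((κ.invTwist.shiftH1 (W.torsionGaloisModule (2 : ℤ))
                  (fun P : WeierstrassCurve.geomTorsion W (2 : ℤ) => AddSubgroup.torsionBy.nsmul P)
                  (J + 1))^[ε] Ψ) = 0) := by
  intro W _ _ κ γ hirr hκ hγ
  exact stub_selmerDual_holds_allPrime W 2 κ γ hirr hκ hγ

end Summit.BirchSwinnertonDyer.BirchSwinnertonDyer.Rank1Residual.SelmerDual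

end
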